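import Summits.AtomisticToContinuum.BoseEinsteinCondensation.Theses.BECStronglyRayleigh
import Summits.AtomisticToContinuum.BoseEinsteinCondensation.Theorems.InsertionFieldDelocalisation.Negative.Toolkit
import Summits.AtomisticToContinuum.BoseEinsteinCondensation.Theorems.InsertionFieldDelocalisation.Negative.Tightness
import Summits.AtomisticToContinuum.BoseEinsteinCondensation.Theorems.InsertionFieldDelocalisation.Negative.PerronExistence
import Summits.AtomisticToContinuum.BoseEinsteinCondensation.Theorems.BECStronglyRayleighInsertionFieldDelocalisationTranslationInvariance
import Summits.AtomisticToContinuum.BoseEinsteinCondensation.Theorems.BECStronglyRayleighInsertionFieldDelocalisationEmbedding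
import Summits.AtomisticToContinuum.BoseEinsteinCondensation.Theorems.BECStronglyRayleighInsertionFieldDelocalisationTwoBodyBaseFourier
import Summits.AtomisticToContinuum.BoseEinsteinCondensation.Theorems.BECStronglyRayleighInsertionFieldDelocalisationTwoBodyBaseEnergy
import HarnessLib

/-!
# Stub `stub_twoBodyBase` (STUB 1, the two-body base) of line `cosh-budget-penrose-onsager`, crux
# `BECStronglyRayleigh.InsertionFieldDelocalisation` (stmt-AtomisticToContinuum-9673)

**The `N = 2` base of the Penrose–Onsager induction.** Hard-core bosons on `(ℤ/Lℤ)³` = the ferro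
spin-½ XY model `H = xyTorus 3 L 1` (occupied = index `0`, `1_S = fun z => if z ∈ S then 0 else 1`).
For an admissible two-particle datum `ψ` (sector `S³ = 2 - L³/2`, `ψ ≠ 0`, `Hψ = E(2)ψ`, entrywise
real nonnegative):

* (A) the two-particle insertion field `r^∅_x = Σ_{y ≠ x} Re ψ(1_{{x,y}})` is FLAT, so the crux
  inequality `K1Ineq` holds at level `2` with the floor constant `2` (equality);
* (B) the one-particle profile `u^{t}_x = [x ≠ t] Re ψ(1_{{x,t}})` satisfies the one-particle
  flatness inequality with constant `4`:
  `L³ Σ_t ‖u^t‖²Φ(u^t) ≤ 4 Σ_t ‖u^t‖²`, `‖u‖²Φ(u) = Σu³/Σu + (Σu²)²/(Σu)²`.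

Proof. Translation invariance (landed `stub_translationInvariance`) makes `Re ψ(1_{{x,y}}) = g(x - y)`
for the pair profile `g(v) = [v ≠ 0] Re ψ(1_{{v,0}})`; hence `r^∅ ≡ Σ g` (A), and `u^{t} = g(· - t)`
so (B) is `L³ ‖g‖²Φ(g) ≤ 4‖g‖²`.  The eigen-equation read at `1_{{0,v}}` (landed `stub_embedding`)
is the punctured resolvent equation `Σ_{y∼v} g(y) + E g(v) = s[v = 0]`, `s = Σ_{y∼0} g(y) ≥ 0`; the
two-particle energy satisfies `deg(0) + E ≤ 6/(L³-1) < 8/L²` (`cb1tb_energy_bound`, flat test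
vector), so every nonzero Fourier mode has `Λ_k + E < 0` and Bochner's argument
(`cb1tb_profile_le`) gives `g ≤ 2 · mean(g)`.  Finally `Σg³ ≤ g_max Σg²`, `(Σg²)² ≤ g_max Σg Σg²`
and `g_max ≤ 2Σg/L³` give `L³‖g‖²Φ(g) ≤ 4‖g‖²` (`cb1tb_K1_of_le_mean`).
-/

noncomputable section

namespace Summit.AtomisticToContinuum.BoseEinsteinCondensation.Cruxes.InsertionFieldDelocalisation.CoshBudgetPenroseOnsager

open scoped BigOperators ComplexOrder
open Literature.MathematicalPhysics.QuantumLattice Literature.Probability.LatticeModels Matrix Finset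
open Summit.AtomisticToContinuum.BoseEinsteinCondensation.Theses.BECStronglyRayleigh
open Summit.AtomisticToContinuum.BoseEinsteinCondensation.Theorems.InsertionFieldDelocalisation.Negative
open Summit.AtomisticToContinuum.BoseEinsteinCondensation.Cruxes.InsertionFieldDelocalisation.LogInsertionInfraredBound
  (stub_translationInvariance)
open Summit.AtomisticToContinuum.BoseEinsteinCondensation.Cruxes.InsertionFieldDelocalisation.MobileTrapDirichletEigenfunction
  (stub_embedding)

/-! ### Elementary inequalities for the flatness functional -/

section Functional

variable {ι : Type*} [Fintype ι]

/-- **A profile at most twice its `V`-mean is `4`-flat**: if `0 ≤ r ≤ 2 (Σ r)/V` pointwise, then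
`V · ‖r‖²Φ(r) ≤ 4 ‖r‖²` (`Σr³ ≤ r_max Σr²`, `(Σr²)² ≤ r_max Σr Σr²`). [folklore] -/
theorem cb1tb_K1_of_le_mean (r : ι → ℝ) (hr : ∀ i, 0 ≤ r i) (V : ℝ) (hV : 0 < V)
    (hmax : ∀ i, r i ≤ 2 * (∑ j, r j) / V) : V * K1lhs r ≤ 4 * K1rhs r := by
  rw [K1lhs, K1rhs]
  have hV' : V ≠ 0 := hV.ne'
  have hS1 : 0 ≤ ∑ i, r i := Finset.sum_nonneg fun i _ => hr i
  have hS2 : 0 ≤ ∑ i, r i ^ 2 := Finset.sum_nonneg fun i _ => sq_nonneg (r i)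
  have h3 : ∑ i, r i ^ 3 ≤ (2 * (∑ j, r j) / V) * ∑ i, r i ^ 2 := by
    rw [Finset.mul_sum]
    refine Finset.sum_le_sum fun i _ => ?_
    calc r i ^ 3 = r i * r i ^ 2 := by ring
      _ ≤ (2 * (∑ j, r j) / V) * r i ^ 2 := mul_le_mul_of_nonneg_right (hmax i) (sq_nonneg _)
  have h2 : ∑ i, r i ^ 2 ≤ (2 * (∑ j, r j) / V) * ∑ i, r i := by
    rw [Finset.mul_sum]
    refine Finset.sum_le_sum fun i _ => ?_
    calc r i ^ 2 = r i * r i := by ring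
      _ ≤ (2 * (∑ j, r j) / V) * r i := mul_le_mul_of_nonneg_right (hmax i) (hr i)
  by_cases h0 : ∑ i, r i = 0
  · have hall : ∀ i, r i = 0 := fun i =>
      (Finset.sum_eq_zero_iff_of_nonneg fun j _ => hr j).1 h0 i (Finset.mem_univ i)
    simp [hall]
  have hpos : 0 < ∑ i, r i := lt_of_le_of_ne hS1 (Ne.symm h0)
  have e1 : V * ((∑ i, r i ^ 3) / ∑ i, r i) ≤ 2 * ∑ i, r i ^ 2 := by
    rw [mul_div_assoc', div_le_iff₀ hpos]
    calc V * ∑ i, r i ^ 3 ≤ V * ((2 * (∑ j, r j) / V) * ∑ i, r i ^ 2) :=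
          mul_le_mul_of_nonneg_left h3 hV.le
      _ = 2 * (∑ i, r i ^ 2) * ∑ i, r i := by
          field_simp
  have e2 : V * ((∑ i, r i ^ 2) ^ 2 / (∑ i, r i) ^ 2) ≤ 2 * ∑ i, r i ^ 2 := by
    rw [mul_div_assoc', div_le_iff₀ (by positivity)]
    calc V * (∑ i, r i ^ 2) ^ 2 = V * (∑ i, r i ^ 2) * ∑ i, r i ^ 2 := by ring
      _ ≤ V * (∑ i, r i ^ 2) * ((2 * (∑ j, r j) / V) * ∑ i, r i) :=
          mul_le_mul_of_nonneg_left h2 (by positivity)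
      _ = 2 * (∑ i, r i ^ 2) * (∑ i, r i) ^ 2 := by
          field_simp
  calc V * ((∑ i, r i ^ 3) / (∑ i, r i) + (∑ i, r i ^ 2) ^ 2 / (∑ i, r i) ^ 2)
      = V * ((∑ i, r i ^ 3) / ∑ i, r i) + V * ((∑ i, r i ^ 2) ^ 2 / (∑ i, r i) ^ 2) := by ring
    _ ≤ 2 * ∑ i, r i ^ 2 + 2 * ∑ i, r i ^ 2 := add_le_add e1 e2
    _ = 4 * ∑ i, r i ^ 2 := by ring

/-- **A flat profile is `2`-flat** (the floor, with equality): for a constant field `c` on `V` sites,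
`V · ‖c‖²Φ(c) ≤ 2 ‖c‖²` (both sides vanish at `c = 0` under `x/0 = 0`). [folklore] -/
theorem cb1tb_K1_const (c V : ℝ) (hV : (Fintype.card ι : ℝ) = V) (hV0 : 0 < V) :
    V * K1lhs (fun _ : ι => c) ≤ 2 * K1rhs (fun _ : ι => c) := by
  simp only [K1lhs, K1rhs, Finset.sum_const, Finset.card_univ, nsmul_eq_mul, hV]
  by_cases hc : c = 0
  · subst hc
    simp
  · have hV' : V ≠ 0 := hV0.ne'
    have h1 : V * c ^ 3 / (V * c) = c ^ 2 := by
      field_simp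
    have h2 : (V * c ^ 2) ^ 2 / (V * c) ^ 2 = c ^ 2 := by
      field_simp
    rw [h1, h2]
    linarith

end Functional

/-! ### Translation covariance of pair amplitudes -/

section Pairs

variable (L : ℕ) [NeZero L]

omit [NeZero L] in
/-- **Pair amplitudes are a function of the difference**: for a translation invariant `ψ`,
`ψ(1_{{x,t}}) = ψ(1_{{x-t,0}})`. [folklore] -/
theorem cb1tb_pair_translate (ψ : TensorIndex (TorusSite 3 L) 2 → ℂ)
    (hti : ∀ (a : TorusSite 3 L) (σ : TensorIndex (TorusSite 3 L) 2), ψ (fun x => σ (x + a)) = ψ σ)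
    (x t : TorusSite 3 L) :
    ψ (fun z => if z ∈ insert x ({t} : Finset (TorusSite 3 L)) then 0 else 1) =
      ψ (fun z => if z ∈ insert (x - t) ({0} : Finset (TorusSite 3 L)) then 0 else 1) := by
  rw [← hti t (fun z => if z ∈ insert x ({t} : Finset (TorusSite 3 L)) then 0 else 1)]
  congr 1
  funext z
  simp only [Finset.mem_insert, Finset.mem_singleton, eq_sub_iff_add_eq, add_eq_right]

/-- The flatness functionals are translation invariant: `‖r(· - t)‖²Φ = ‖r‖²Φ`. [folklore] -/
theorem cb1tb_K1lhs_sub (r : TorusSite 3 L → ℝ) (t : TorusSite 3 L) :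
    K1lhs (fun x => r (x - t)) = K1lhs r := by
  have h3 : ∑ x, r (x - t) ^ 3 = ∑ x, r x ^ 3 := Equiv.sum_comp (Equiv.subRight t) (fun x => r x ^ 3)
  have h2 : ∑ x, r (x - t) ^ 2 = ∑ x, r x ^ 2 := Equiv.sum_comp (Equiv.subRight t) (fun x => r x ^ 2)
  have h1 : ∑ x, r (x - t) = ∑ x, r x := Equiv.sum_comp (Equiv.subRight t) r
  rw [K1lhs, K1lhs, h1, h2, h3]

/-- The `ω`-weight is translation invariant: `‖r(· - t)‖² = ‖r‖²`. [folklore] -/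
theorem cb1tb_K1rhs_sub (r : TorusSite 3 L → ℝ) (t : TorusSite 3 L) :
    K1rhs (fun x => r (x - t)) = K1rhs r := by
  have h2 : ∑ x, r (x - t) ^ 2 = ∑ x, r x ^ 2 := Equiv.sum_comp (Equiv.subRight t) (fun x => r x ^ 2)
  rw [K1rhs, K1rhs, h2]

end Pairs

/-! ### The two-body base -/

/-- **The two-body base for one admissible datum**: parts (A) and (B) of `stub_twoBodyBase` for a
fixed admissible two-particle `ψ` (translation invariance ⇒ pair profile `g`; `stub_embedding` ⇒
punctured resolvent equation; `cb1tb_energy_bound` + `cb1tb_profile_le` ⇒ `g ≤ 2 mean(g)`;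
`cb1tb_K1_of_le_mean`, `cb1tb_K1_const`). [folklore] -/
theorem cb1tb_main (L : ℕ) [NeZero L] (hL : 2 ≤ L) (ψ : TensorIndex (TorusSite 3 L) 2 → ℂ)
    (hadm : ψ ∈ spinZSector 1 (((2 : ℕ) : ℝ) - (L : ℝ) ^ 3 / 2) ∧ ψ ≠ 0 ∧
      (xyTorus 3 L 1).mulVec ψ =
        ((lowestEnergyInSector 1 (xyTorus 3 L 1) (((2 : ℕ) : ℝ) - (L : ℝ) ^ 3 / 2) : ℝ) : ℂ) • ψ ∧
      ∀ σ, 0 ≤ (ψ σ).re ∧ (ψ σ).im = 0) :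
    K1Ineq 2 L 2 ψ ∧
      ((L : ℝ) ^ 3 * ∑ T ∈ (univ : Finset (TorusSite 3 L)).powersetCard (2 - 1), K1lhs (fun x => if x ∉ T then ((ψ) (fun z => if z ∈ insert x T then 0 else 1)).re else 0) ≤
        (4) * ∑ T ∈ (univ : Finset (TorusSite 3 L)).powersetCard (2 - 1), K1rhs (fun x => if x ∉ T then ((ψ) (fun z => if z ∈ insert x T then 0 else 1)).re else 0)) := by
  obtain ⟨hsec, hne, heig, hnn⟩ := hadm
  set E := lowestEnergyInSector 1 (xyTorus 3 L 1) (((2 : ℕ) : ℝ) - (L : ℝ) ^ 3 / 2) with hEdef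
  have hL3 : 8 ≤ L ^ 3 :=
    calc 8 = 2 ^ 3 := by norm_num
      _ ≤ L ^ 3 := Nat.pow_le_pow_left hL 3
  have hLr : (2 : ℝ) ≤ L := by exact_mod_cast hL
  have hV0 : (0 : ℝ) < (L : ℝ) ^ 3 := by positivity
  have hcard : (Fintype.card (TorusSite 3 L) : ℝ) = (L : ℝ) ^ 3 := by
    rw [Summit.AtomisticToContinuum.BoseEinsteinCondensation.Theorems.InsertionFieldDelocalisation.Negative.card_torusSite]
    push_cast
    ring
  -- translation invariance (Perron uniqueness, landed)
  have hti : ∀ (a : TorusSite 3 L) (σ : TensorIndex (TorusSite 3 L) 2), ψ (fun x => σ (x + a)) = ψ σ :=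
    stub_translationInvariance L hL 2 le_rfl (by omega) ψ hsec hne heig hnn
  -- the pair profile `g(v) = [v ≠ 0] Re ψ(1_{{v,0}})`
  set g : TorusSite 3 L → ℝ := fun v => if v ∉ ({0} : Finset (TorusSite 3 L)) then
      (ψ (fun z => if z ∈ insert v ({0} : Finset (TorusSite 3 L)) then 0 else 1)).re else 0 with hg
  have hgv : ∀ v, g v = if v ∉ ({0} : Finset (TorusSite 3 L)) then
      (ψ (fun z => if z ∈ insert v ({0} : Finset (TorusSite 3 L)) then 0 else 1)).re else 0 :=
    fun v => rfl
  have hg0 : g 0 = 0 := by rw [hgv]; simp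
  have hgnn : ∀ v, 0 ≤ g v := fun v => by
    rw [hgv]
    split_ifs
    exacts [le_rfl, (hnn _).1]
  -- one-particle fields with background `{t}` are translates of `g`
  have hT1 : ∀ t x : TorusSite 3 L, (if x ∉ ({t} : Finset (TorusSite 3 L)) then
      (ψ (fun z => if z ∈ insert x ({t} : Finset (TorusSite 3 L)) then 0 else 1)).re else 0) =
        g (x - t) := by
    intro t x
    rw [hgv]
    by_cases hx : x = t
    · subst hx
      simp
    · have hx' : x ∉ ({t} : Finset (TorusSite 3 L)) := by simpa using hx
      have hx'' : x - t ∉ ({0} : Finset (TorusSite 3 L)) := by simpa [sub_eq_zero] using hx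
      rw [if_pos hx', if_pos hx'', cb1tb_pair_translate L ψ hti x t]
  have hfun : ∀ t : TorusSite 3 L, (fun x => if x ∉ ({t} : Finset (TorusSite 3 L)) then
      (ψ (fun z => if z ∈ insert x ({t} : Finset (TorusSite 3 L)) then 0 else 1)).re else 0) =
        fun x => g (x - t) := fun t => funext (hT1 t)
  -- the punctured resolvent equation `Σ_{y ∼ v} g y + E g v = s [v = 0]`
  have hA : ∀ v, (∑ y, if (torusGraph 3 L).Adj v y then g y else 0) + E * g v =
      if v = 0 then (∑ y, if (torusGraph 3 L).Adj 0 y then g y else 0) else 0 := by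
    intro v
    have h := stub_embedding L E ψ heig ({0} : Finset (TorusSite 3 L)) v
    rw [Finset.sum_singleton, Finset.erase_singleton] at h
    -- the hops of the background particle, re-centred: `Σ_{b ∼ 0} g(v - b) = Σ_{y ∼ v} g(y)`
    have hfirst : (∑ b, if b ∉ ({0} : Finset (TorusSite 3 L)) ∧ (torusGraph 3 L).Adj 0 b then
        (if v ∉ insert b (∅ : Finset (TorusSite 3 L)) then
          (ψ (fun z => if z ∈ insert v (insert b (∅ : Finset (TorusSite 3 L))) then 0 else 1)).re
        else 0) else 0) = ∑ y, if (torusGraph 3 L).Adj v y then g y else 0 := by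
      calc (∑ b, if b ∉ ({0} : Finset (TorusSite 3 L)) ∧ (torusGraph 3 L).Adj 0 b then
            (if v ∉ insert b (∅ : Finset (TorusSite 3 L)) then
              (ψ (fun z => if z ∈ insert v (insert b (∅ : Finset (TorusSite 3 L))) then 0 else 1)).re
            else 0) else 0)
          = ∑ b, if (torusGraph 3 L).Adj 0 b then g (v - b) else 0 := by
            refine Finset.sum_congr rfl fun b _ => ?_
            by_cases hb : (torusGraph 3 L).Adj 0 b
            · rw [if_pos ⟨by simpa using hb.ne.symm, hb⟩, if_pos hb]
              exact hT1 b v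
            · rw [if_neg (fun h' => hb h'.2), if_neg hb]
        _ = ∑ y, if (torusGraph 3 L).Adj v y then g y else 0 := by
            refine Fintype.sum_equiv (Equiv.subLeft v) _ _ fun b => ?_
            rw [Equiv.subLeft_apply]
            have hiff : (torusGraph 3 L).Adj 0 b ↔ (torusGraph 3 L).Adj v (v - b) := by
              rw [cb1tb_adj_iff_sub v (v - b), sub_sub_cancel_left, (torusGraph 3 L).adj_comm 0 b,
                cb1tb_adj_iff_sub b 0, zero_sub]
            by_cases hb : (torusGraph 3 L).Adj 0 b
            · rw [if_pos hb, if_pos (hiff.1 hb)]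
            · rw [if_neg hb, if_neg (fun h' => hb (hiff.2 h'))]
    have hsecond : ∀ y, (if y ∉ ({0} : Finset (TorusSite 3 L)) then
        (ψ (fun z => if z ∈ insert y ({0} : Finset (TorusSite 3 L)) then 0 else 1)).re else 0) =
          g y := fun y => rfl
    rw [hfirst] at h
    simp only [hsecond] at h
    by_cases hv : v = 0
    · subst hv
      simp only [Finset.mem_singleton, if_true] at h ⊢
      linarith
    · rw [if_neg hv]
      rw [if_neg (by simpa using hv)] at h
      linarith
  -- the energy bound and the profile bound `g ≤ 2 mean(g)`
  have hEB := cb1tb_energy_bound L hL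
  have h8 : (∑ b : TorusSite 3 L, (if (torusGraph 3 L).Adj 0 b then (1 : ℝ) else 0)) + E <
      8 / (L : ℝ) ^ 2 := by
    have hL3r : (8 : ℝ) ≤ (L : ℝ) ^ 3 := by exact_mod_cast hL3
    have hden : (0 : ℝ) < (L : ℝ) ^ 3 - 1 := by linarith
    have hle : (∑ b : TorusSite 3 L, (if (torusGraph 3 L).Adj 0 b then (1 : ℝ) else 0)) + E ≤
        6 / ((L : ℝ) ^ 3 - 1) := by
      rw [le_div_iff₀ hden]
      exact hEB
    have hlt : 6 / ((L : ℝ) ^ 3 - 1) < 8 / (L : ℝ) ^ 2 := by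
      rw [div_lt_div_iff₀ hden (by positivity)]
      nlinarith [mul_le_mul_of_nonneg_right hLr (sq_nonneg (L : ℝ))]
    exact hle.trans_lt hlt
  have hs : 0 ≤ ∑ y, (if (torusGraph 3 L).Adj 0 y then g y else 0) :=
    Finset.sum_nonneg fun y _ => by
      split_ifs
      exacts [hgnn y, le_rfl]
  have hprof : ∀ v, g v ≤ 2 * (∑ x, g x) / (L : ℝ) ^ 3 := fun v => by
    have h := cb1tb_profile_le L hL g E _ hs h8 hA v
    rw [hg0, add_zero] at h
    exact h
  refine ⟨?_, ?_⟩
  · -- (A): the two-particle insertion field at `T = ∅` is the constant `Σ g`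
    rw [K1Ineq, show (2 - 2 : ℕ) = 0 from rfl, Finset.powersetCard_zero, Finset.sum_singleton,
      Finset.sum_singleton]
    have hfield : field ψ ∅ = fun _ => ∑ v, g v := by
      funext x
      rw [field, ← Equiv.sum_comp (Equiv.subLeft x) g]
      refine Finset.sum_congr rfl fun y _ => ?_
      rw [Equiv.subLeft_apply]
      by_cases hxy : x = y
      · subst hxy
        rw [if_neg (fun h' => h'.2.2 rfl), sub_self, hg0]
      · rw [if_pos ⟨Finset.notMem_empty _, Finset.notMem_empty _, hxy⟩, Finset.insert_empty,
          ← hT1 y x, if_pos (by simpa using hxy)]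
    rw [hfield]
    exact cb1tb_K1_const _ _ hcard hV0
  · -- (B): the one-particle profile is `g(· - t)`, and `L³ ‖g‖²Φ(g) ≤ 4 ‖g‖²`
    have hl : ∑ T ∈ (univ : Finset (TorusSite 3 L)).powersetCard (2 - 1), K1lhs (fun x => if x ∉ T
        then ((ψ) (fun z => if z ∈ insert x T then 0 else 1)).re else 0) = (L : ℝ) ^ 3 * K1lhs g := by
      rw [show (2 - 1 : ℕ) = 1 from rfl, Finset.powersetCard_one, Finset.sum_map]
      simp only [Function.Embedding.coeFn_mk, hfun, cb1tb_K1lhs_sub]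
      rw [Finset.sum_const, Finset.card_univ, nsmul_eq_mul, hcard]
    have hr : ∑ T ∈ (univ : Finset (TorusSite 3 L)).powersetCard (2 - 1), K1rhs (fun x => if x ∉ T
        then ((ψ) (fun z => if z ∈ insert x T then 0 else 1)).re else 0) = (L : ℝ) ^ 3 * K1rhs g := by
      rw [show (2 - 1 : ℕ) = 1 from rfl, Finset.powersetCard_one, Finset.sum_map]
      simp only [Function.Embedding.coeFn_mk, hfun, cb1tb_K1rhs_sub]
      rw [Finset.sum_const, Finset.card_univ, nsmul_eq_mul, hcard]
    rw [hl, hr]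
    have h7 := cb1tb_K1_of_le_mean g hgnn ((L : ℝ) ^ 3) hV0 hprof
    calc (L : ℝ) ^ 3 * ((L : ℝ) ^ 3 * K1lhs g) ≤ (L : ℝ) ^ 3 * (4 * K1rhs g) :=
          mul_le_mul_of_nonneg_left h7 hV0.le
      _ = 4 * ((L : ℝ) ^ 3 * K1rhs g) := by ring

/-- **STUB 1 · `stub_twoBodyBase` — the two-body base of the Penrose–Onsager induction.** For every
`L ≥ 2` and every admissible two-particle datum `ψ` of `xyTorus 3 L 1` (sector `2 - L³/2`, nonzero,
eigenvector at the sector energy, entrywise real nonnegative): (A) `K1Ineq 2 L 2 ψ` (the two-particle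
insertion field `r^∅` is flat by translation invariance); (B) the one-particle flatness inequality at
level `2` with constant `4` (the pair profile is at most twice its mean, by the punctured resolvent
equation, the variational bound `deg(0) + E(2) ≤ 6/(L³-1) < 8/L²` and Bochner positivity of the
nonzero Fourier modes). [folklore] -/
theorem stub_twoBodyBase :
    ∀ (L : ℕ) [NeZero L], 2 ≤ L →
      (∀ ψ : TensorIndex (TorusSite 3 L) 2 → ℂ,
        (ψ ∈ spinZSector 1 (((2 : ℕ) : ℝ) - (L : ℝ) ^ 3 / 2) ∧ ψ ≠ 0 ∧
          (xyTorus 3 L 1).mulVec ψ =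
            ((lowestEnergyInSector 1 (xyTorus 3 L 1) (((2 : ℕ) : ℝ) - (L : ℝ) ^ 3 / 2) : ℝ) : ℂ) • ψ ∧
          ∀ σ, 0 ≤ (ψ σ).re ∧ (ψ σ).im = 0) →
        K1Ineq 2 L 2 ψ) ∧
      (∀ ψ : TensorIndex (TorusSite 3 L) 2 → ℂ,
        (ψ ∈ spinZSector 1 (((2 : ℕ) : ℝ) - (L : ℝ) ^ 3 / 2) ∧ ψ ≠ 0 ∧
          (xyTorus 3 L 1).mulVec ψ =
            ((lowestEnergyInSector 1 (xyTorus 3 L 1) (((2 : ℕ) : ℝ) - (L : ℝ) ^ 3 / 2) : ℝ) : ℂ) • ψ ∧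
          ∀ σ, 0 ≤ (ψ σ).re ∧ (ψ σ).im = 0) →
        ((L : ℝ) ^ 3 * ∑ T ∈ (univ : Finset (TorusSite 3 L)).powersetCard (2 - 1), K1lhs (fun x => if x ∉ T then ((ψ) (fun z => if z ∈ insert x T then 0 else 1)).re else 0) ≤
          (4) * ∑ T ∈ (univ : Finset (TorusSite 3 L)).powersetCard (2 - 1), K1rhs (fun x => if x ∉ T then ((ψ) (fun z => if z ∈ insert x T then 0 else 1)).re else 0))) := by
  intro L _ hL
  exact ⟨fun ψ h => (cb1tb_main L hL ψ h).1, fun ψ h => (cb1tb_main L hL ψ h).2⟩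

end Summit.AtomisticToContinuum.BoseEinsteinCondensation.Cruxes.InsertionFieldDelocalisation.CoshBudgetPenroseOnsager

end
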